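import Mathlib
import Summits.Ventures.HodgeRepro.Tier4.Target
import Summits.Ventures.HodgeRepro.Tier4.Common.TargetBall
import Summits.Ventures.HodgeRepro.Tier4.Line3.InvariantMajorantDef
import Summits.Ventures.HodgeRepro.Tier4.Line3.OffMainMassAssembly

/-!
# Tier4/Line3/InvMajorantMassBridge — the mass of the invariant majorant density over a domain from a pointwise
theta bound (the `hmass` hypothesis of t4-L2-p3's `term_dominated_of_growthInv`)

Blind re-derivation cell `pub-hodge-repro`, Tier 4 (README §9–§10), LINE L3, seat t4-L2-p2 (gen 2) on t4-L2-p3 g2's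
cut (S13121; lead g385 S13015 (c)).  Target tree path `lean/Summits/Ventures/HodgeRepro/Tier4/Line3/InvMajorantMassBridge.lean`.

If on a measurable `F ⊆ ball` with `nsq ≤ r₀` the series of invariant majorants is summable with sum `≤ A` at every
point (t4-x2's pointwise theta bound on the compact `{nsq ≤ r₀}`), then the invariant majorant density
`invMajorantDensity = ofReal (∑′ invMajorant)` is `≤ ofReal (max A 0)` on `F`, and its integral over `F` is at most
`ofReal (max A 0 · vol(ball))` — the shape `hmass` of `term_dominated_of_growthInv` / `offMainMass_of_growthInv`
(InvariantRouteAssembly p674244).  Inputs: `invMajorant_nonneg` (InvariantMajorantDef), t4-L2-p1's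
`volume_ball_ne_top` (OffMainMassAssembly), Mathlib's `ENNReal.ofReal_tsum_of_nonneg`, `setLIntegral_mono'`,
`setLIntegral_const`.  No printed input.

Nothing here asserts anything about the Hodge conjecture for CM abelian varieties, which is NOT proved (HC_CM is NOT
proved by anyone in this repository).
-/

set_option autoImplicit false

noncomputable section

namespace Summit.Ventures.HodgeRepro.Tier4.Line3

open Summit.Ventures.HodgeRepro.Tier4
open MeasureTheory
open scoped ENNReal

namespace T4Data

variable (X : T4Data)

/-- **Pointwise bound ⇒ bounded density**: on `{nsq ≤ r₀}` the invariant majorant density is `≤ ofReal (max A 0)`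
when the series of invariant majorants is summable with sum `≤ A` there. -/
theorem invMajorantDensity_le_of_pointwise (D : X.ThetaData) (S' : Set X.LineTuple) (xm : X.Tuple) (e c₁ : ℝ)
    {A : ℝ} {z : Fin 2 → ℂ}
    (hz : Summable (fun w : X.invSet S' xm => X.invMajorant D e c₁ w.1 z) ∧
      ∑' w : X.invSet S' xm, X.invMajorant D e c₁ w.1 z ≤ A) :
    X.invMajorantDensity D S' xm e c₁ z ≤ ENNReal.ofReal (max A 0) := by
  obtain ⟨hsum, hle⟩ := hz
  have h1 : ENNReal.ofReal (∑' w : X.invSet S' xm, X.invMajorant D e c₁ w.1 z) =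
      ∑' w : X.invSet S' xm, ENNReal.ofReal (X.invMajorant D e c₁ w.1 z) :=
    ENNReal.ofReal_tsum_of_nonneg (fun w => X.invMajorant_nonneg D e c₁ w.1 z) hsum
  have h2 : X.invMajorantDensity D S' xm e c₁ z =
      ∑' w : X.invSet S' xm, ENNReal.ofReal (X.invMajorant D e c₁ w.1 z) := rfl
  rw [h2, ← h1]
  exact ENNReal.ofReal_le_ofReal (hle.trans (le_max_left _ _))

/-- **THE BRIDGE — the mass hypothesis `hmass` of `term_dominated_of_growthInv` from a pointwise theta bound**: for a
measurable `F ⊆ ball` on which `nsq ≤ r₀`, and a bound `A` on the summable series of invariant majorants at every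
`z` with `nsq z ≤ r₀`, the integral of the invariant majorant density over `F` is at most
`ofReal (max A 0 · vol(ball))`. -/
theorem invMajorantMass_of_pointwise (D : X.ThetaData) (S' : Set X.LineTuple) (xm : X.Tuple) (e c₁ : ℝ)
    {F : Set (Fin 2 → ℂ)} (hFm : MeasurableSet F) (hFb : F ⊆ ball) {r₀ : ℝ} (hFr : ∀ z ∈ F, nsq z ≤ r₀)
    {A : ℝ} (hA : ∀ z, nsq z ≤ r₀ → Summable (fun w : X.invSet S' xm => X.invMajorant D e c₁ w.1 z) ∧
      ∑' w : X.invSet S' xm, X.invMajorant D e c₁ w.1 z ≤ A) :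
    ∃ M_F : ℝ, 0 ≤ M_F ∧ ∫⁻ z in F, X.invMajorantDensity D S' xm e c₁ z ≤ ENNReal.ofReal M_F := by
  refine ⟨max A 0 * (volume (ball : Set (Fin 2 → ℂ))).toReal,
    mul_nonneg (le_max_right _ _) ENNReal.toReal_nonneg, ?_⟩
  have hpt : ∀ z ∈ F, X.invMajorantDensity D S' xm e c₁ z ≤ ENNReal.ofReal (max A 0) := fun z hz =>
    X.invMajorantDensity_le_of_pointwise D S' xm e c₁ (hA z (hFr z hz))
  calc ∫⁻ z in F, X.invMajorantDensity D S' xm e c₁ z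
      ≤ ∫⁻ _ in F, ENNReal.ofReal (max A 0) := setLIntegral_mono' hFm hpt
    _ = ENNReal.ofReal (max A 0) * volume F := setLIntegral_const F _
    _ ≤ ENNReal.ofReal (max A 0) * volume (ball : Set (Fin 2 → ℂ)) := by
        gcongr
    _ = ENNReal.ofReal (max A 0 * (volume (ball : Set (Fin 2 → ℂ))).toReal) := by
        rw [ENNReal.ofReal_mul (le_max_right _ _), ENNReal.ofReal_toReal volume_ball_ne_top]

end T4Data

end Summit.Ventures.HodgeRepro.Tier4.Line3

end
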